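import Mathlib
import Summits.MatrixMultiplication.Statement
import Summits.MatrixMultiplication.MatrixMultiplication.Theorems.GraphEquationsPolarLemma
import Summits.MatrixMultiplication.MatrixMultiplication.Theorems.GraphEquationsSquaredSystems

/-!
# Kernel-field DEFLATION of the graph equations (M15c; cell `decomp-mm`, lens-5 g28)

Helper kernel beneath the attacked crux `MultiplicityReduction` (stmt-MatrixMultiplication-27806) of
route `GraphEquations`, registered line `purisplit` (stubs OR′ / BOP′; rung `K = 1` of BOP′ is
`boundedOrderPurification_one`, M13b).  This file attacks RUNG `K = 2` of BOP′ —
`EqAdmissibleIdealIso β 2 → EqAdmissiblePure β'` (`β < β'`) — by transplanting NEWTON DEFLATION of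
singular isolated zeros (Leykin–Verschelde–Zhao 2006, Thm. 3.1; Dayton–Zeng 2005, §3;
Hauenstein–Wampler 2013) to the graph `W_n = {C = AB}`; infrastructure in
`GraphEquationsDerivations` (M15a) and the polar lemma in `GraphEquationsPolarLemma` (M15b).
Dictionary:

* isolated singular POINT `x*` of `F = 0`      ↦ the graph point over a base pair `y = (A₀,B₀)`,
  the fibre directions being the `n²` variables `F = C − AB` (`Ψ : G(a,b;F) ↦ G(a,b;c−ab)`, M13);
* multiplicity / depth of `x*`                 ↦ the ISOLATION ORDER `K` of `InitIsolatedFam u K y`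
  (lowest `F`-forms of members of the test ideal have only the trivial common zero over `y`);
* one deflation step `F ↦ (F, JF·λ)`, `λ ∈ ker JF(x*)` generic
                                               ↦ `u ↦ u ⧺ D_μ u` with the DERIVATION
  `D_μ = Σ_q μ_q(a,b) ∂/∂c_q` along a COEFFICIENT FIELD `μ : (a,b) ↦ ℂ^{n×n}` — under `Ψ` this is
  the polar `Σ_q μ_q ∂/∂F_q` (`substF_polarDeriv`), which LOWERS `F`-ORDER BY ONE
  (`homogeneousComponent_polarDeriv`);
* "deflation regularises after `≤` depth steps" ↦ **order `2` ⇒ order `1` in ONE round**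
  (`InitIsolatedFam.deflate`), and order `1` ⇒ REDUCED is rung M13b;
* `λ ∈ ker JF(x*)`                              ↦ `μ(y) ∈ N(y)`, the common kernel of the
  specialised LINEAR members — automatic for KERNEL FIELDS, i.e. fields with `D_μ t ∈ I` for all
  tests `t` (`derivC_mem_graphIdeal_iff`: `Σ_q μ_q · (F-linear coefficient of t)_q = 0` in `ℂ[A,B]`),
  which is exactly what CORRECTNESS of the deflated system requires
  (`DeflatesTo.derivC_mem_graphIdeal`, `Correct.of_deflatesTo`).

## What is proved (no `sorry`)

* `InitIsolatedFam.deflate`, `IdealInitIsolatedSet.deflate`, `EqSystem.IdealInitIsolatedAt.deflate`,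
  `….reducedAt_of_deflate` — ONE ROUND: test ideal initially isolated to order `2` over `y` ⇒ ∃ `γ`
  such that for EVERY field `μ` with `μ(y) = γ`, every system containing the tests of `E` and their
  `D_μ`-derivatives is initially isolated to order `1` over `y`, hence REDUCED at the graph point if
  correct.
* `KernelFieldDeflation β` (∃-form residual) with `kernelFieldDeflation_iff :
  KernelFieldDeflation β ↔ EqAdmissibleIdealIso β 1` (⇐ by the zero field) — an EQUIVALENT
  reformulation of the rung-`1` class — and `boundedOrderPurification_two_of_kernelFieldDeflation`.
* the SHARP split of rung `2`: `UniformKernelFieldDeflation β β'` (UNDECIDED, the open residual: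
  every cheap correct order-`2` system has a KERNEL FIELD of cost `O(n^{β'})` whose value at some
  base pair is a deflation direction) and `ForwardModeAD` (ROUTINE bookkeeping: forward-mode
  differentiation of a straight-line program along `D_μ`, cost `≤ 4·cost E + cost E_μ`; Wengert
  1964, BCS97 §7.1), with `kernelFieldDeflation_of_uniform` and
  `boundedOrderPurification_two_of_uniform : (∀ 2 ≤ β < β', Uniform… β β') → ForwardModeAD → BOP′(2)`.
* `exists_direction_of_eqAdmissibleIdealIso_two` — the DIRECTION half of the residual is a theorem;
  only the COST of a kernel field reaching a good value is open.

Sources: Leykin–Verschelde–Zhao, Newton's method with deflation for isolated singularities, TCS 359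
(2006) [doi:10.1016/j.tcs.2006.02.018]; Dayton–Zeng, ISSAC 2005 [doi:10.1145/1073884.1073901];
Hauenstein–Wampler, Isosingular sets and deflation, FoCM 13 (2013); Bürgisser–Clausen–Shokrollahi
1997 (BCS97) §7.1 (derivatives of straight-line programs).  No sorry.
-/

set_option linter.dupNamespace false

noncomputable section

open scoped BigOperators

namespace Summit.MatrixMultiplication.MatrixMultiplication.Theorems.GraphEquations

open MvPolynomial
open Literature.Computability.AlgebraicComplexity

variable {n : ℕ}

/-! ## One deflation round: initially isolated to order `2` ⇒ the deflated family is to order `1` -/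

/-- **DEFLATION OF A FAMILY (explicit data).**  Let `u_o = G_o(a,b;f)` be initially isolated to
order `2` over `y` with data `(ν, G)`.  Then there is a direction `γ ∈ ℂ^{n×n}` — in the common
kernel of the specialised linear members — such that for EVERY coefficient field `μ` with
`μ(y) = γ` the family `u ⧺ (D_μ u_o)_o` is initially isolated to order `1` over `y`. -/
theorem InitIsolatedFam.deflate_of_data {T : ℕ} {u : Fin T → MvPolynomial (GraphVars n) ℂ}
    {y : MatMulVars n → ℂ} (ν : Fin T → ℕ) (G : Fin T → FPoly n) (hν : ∀ o, ν o ≤ 2)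
    (hG : ∀ o, substF n (G o) = u o) (hlow : ∀ o, ∀ j < ν o, homogeneousComponent j (G o) = 0)
    (hiso : ∀ F₀ : Fin n × Fin n → ℂ,
      (∀ o, eval F₀ (map (eval y) (homogeneousComponent (ν o) (G o))) =
          eval 0 (map (eval y) (homogeneousComponent (ν o) (G o)))) → F₀ = 0) :
    ∃ γ : Fin n × Fin n → ℂ,
      (∀ o, ν o = 1 → eval γ (map (eval y) (homogeneousComponent 1 (G o))) = 0) ∧
      ∀ μ : Fin n × Fin n → MvPolynomial (MatMulVars n) ℂ, (∀ q, eval y (μ q) = γ q) →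
        InitIsolatedFam (Fin.append u fun o => derivC μ (u o)) 1 y := by
  classical
  set P : Fin T → MvPolynomial (Fin n × Fin n) ℂ := fun o => map (eval y) (homogeneousComponent (ν o) (G o))
    with hPdef
  have hP : ∀ o, (P o).IsHomogeneous (ν o) := fun o => (homogeneousComponent_isHomogeneous _ _).map _
  obtain ⟨γ, hγN, hγ⟩ := exists_deflation_direction P ν hP hν hiso
  refine ⟨γ, fun o ho => by have := hγN o ho; simp only [hPdef, ho] at this; exact this, fun μ hμ => ?_⟩
  have hμ' : (fun q => eval y (μ q)) = γ := funext hμ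
  refine ⟨Fin.append (fun o => min (ν o) 1) (fun o => ν o - 1), Fin.append G (fun o => polarDeriv μ (G o)),
    fun i => ?_, fun i => ?_, fun i => ?_, fun F₀ hF => ?_⟩
  · induction i using Fin.addCases with
    | left o => simp only [Fin.append_left]; exact min_le_right _ _
    | right o => simp only [Fin.append_right]; have := hν o; omega
  · induction i using Fin.addCases with
    | left o => simp only [Fin.append_left, hG]
    | right o => simp only [Fin.append_right, substF_polarDeriv, hG]
  · induction i using Fin.addCases with
    | left o =>
      intro j hj; simp only [Fin.append_left] at hj ⊢; exact hlow o j (lt_of_lt_of_le hj (min_le_left _ _))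
    | right o =>
      intro j hj; simp only [Fin.append_right] at hj ⊢
      rw [homogeneousComponent_polarDeriv, hlow o (j + 1) (by omega), polarDeriv_zero]
  · refine hγ F₀ (fun o ho => ?_) (fun o ho => ?_)
    · have h := hF (Fin.castAdd T o)
      simp only [Fin.append_left, ho, min_self] at h
      have hPo : P o = map (eval y) (homogeneousComponent 1 (G o)) := by simp only [hPdef, ho]
      rw [hPo, h]
      exact eval_zero_of_isHomogeneous ((homogeneousComponent_isHomogeneous 1 (G o)).map (eval y))
        one_ne_zero
    · have h := hF (Fin.natAdd T o)
      simp only [Fin.append_right, ho, show (2 - 1 : ℕ) = 1 from rfl] at h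
      rw [homogeneousComponent_polarDeriv, map_polarDeriv, hμ', show (1 + 1 : ℕ) = 2 from rfl] at h
      have hPo : P o = map (eval y) (homogeneousComponent 2 (G o)) := by simp only [hPdef, ho]
      rw [hPo, h]
      exact eval_zero_of_isHomogeneous
        (IsHomogeneous.polarDeriv ((homogeneousComponent_isHomogeneous 2 (G o)).map (eval y)) γ)
        (by norm_num)

/-- **DEFLATION OF A FAMILY.**  `InitIsolatedFam u 2 y ⇒ ∃ γ ∀ μ, μ(y) = γ ⇒
InitIsolatedFam (u ⧺ D_μ u) 1 y`. -/
theorem InitIsolatedFam.deflate {T : ℕ} {u : Fin T → MvPolynomial (GraphVars n) ℂ}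
    {y : MatMulVars n → ℂ} (h : InitIsolatedFam u 2 y) :
    ∃ γ : Fin n × Fin n → ℂ, ∀ μ : Fin n × Fin n → MvPolynomial (MatMulVars n) ℂ,
      (∀ q, eval y (μ q) = γ q) → InitIsolatedFam (Fin.append u fun o => derivC μ (u o)) 1 y := by
  obtain ⟨ν, G, hν, hG, hlow, hiso⟩ := h
  obtain ⟨γ, -, hγ⟩ := InitIsolatedFam.deflate_of_data ν G hν hG hlow hiso
  exact ⟨γ, hγ⟩

/-! ## Ideals and systems -/

/-- The ideal `span S` is initially isolated to order `K` over `y`: some finite family in it is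
(`EqSystem.IdealInitIsolatedAt` is the case `S = ` the tests of a system). -/
def IdealInitIsolatedSet (S : Set (MvPolynomial (GraphVars n) ℂ)) (K : ℕ) (y : MatMulVars n → ℂ) : Prop :=
  ∃ (T : ℕ) (u : Fin T → MvPolynomial (GraphVars n) ℂ), (∀ i, u i ∈ Ideal.span S) ∧ InitIsolatedFam u K y

/-- The set of test polynomials of a system. -/
def EqSystem.testSet (E : EqSystem n) : Set (MvPolynomial (GraphVars n) ℂ) :=
  Set.range fun o : Fin E.tests.length => E.testPoly (E.tests.get o)

/-- Membership in the test set. -/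
theorem EqSystem.mem_testSet_iff (E : EqSystem n) (t : MvPolynomial (GraphVars n) ℂ) :
    t ∈ E.testSet ↔ ∃ j ∈ E.tests, E.testPoly j = t := by
  constructor
  · rintro ⟨o, rfl⟩; exact ⟨_, List.get_mem _ _, rfl⟩
  · rintro ⟨j, hj, rfl⟩
    obtain ⟨o, ho⟩ := List.mem_iff_get.mp hj
    exact ⟨o, by simp only [ho]⟩

/-- `IdealInitIsolatedAt` is `IdealInitIsolatedSet` of the test set (definitional). -/
theorem EqSystem.idealInitIsolatedAt_iff (E : EqSystem n) (K : ℕ) (y : MatMulVars n → ℂ) :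
    E.IdealInitIsolatedAt K y ↔ IdealInitIsolatedSet E.testSet K y := Iff.rfl

/-- Monotonicity in the generating set. -/
theorem IdealInitIsolatedSet.mono {S S' : Set (MvPolynomial (GraphVars n) ℂ)} {K : ℕ}
    {y : MatMulVars n → ℂ} (h : IdealInitIsolatedSet S K y) (hSS' : Ideal.span S ≤ Ideal.span S') :
    IdealInitIsolatedSet S' K y := by
  obtain ⟨T, u, hu, hfam⟩ := h
  exact ⟨T, u, fun i => hSS' (hu i), hfam⟩

/-- **DEFLATION OF AN IDEAL.**  If `span S` is initially isolated to order `2` over `y`, there is a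
direction `γ` such that for every coefficient field `μ` with `μ(y) = γ` and every `S'` containing
`S` and the derivatives `D_μ S`, `span S'` is initially isolated to order `1` over `y`. -/
theorem IdealInitIsolatedSet.deflate {S : Set (MvPolynomial (GraphVars n) ℂ)} {y : MatMulVars n → ℂ}
    (h : IdealInitIsolatedSet S 2 y) :
    ∃ γ : Fin n × Fin n → ℂ, ∀ μ : Fin n × Fin n → MvPolynomial (MatMulVars n) ℂ,
      (∀ q, eval y (μ q) = γ q) → ∀ S' : Set (MvPolynomial (GraphVars n) ℂ), S ⊆ S' →
        (∀ t ∈ S, derivC μ t ∈ S') → IdealInitIsolatedSet S' 1 y := by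
  obtain ⟨T, u, hu, hfam⟩ := h
  obtain ⟨γ, hγ⟩ := hfam.deflate
  refine ⟨γ, fun μ hμ S' hSS' hD => ⟨T + T, _, fun i => ?_, hγ μ hμ⟩⟩
  induction i using Fin.addCases with
  | left o => simp only [Fin.append_left]; exact Ideal.span_mono hSS' (hu o)
  | right o => simp only [Fin.append_right]; exact derivC_mem_span μ hSS' hD (hu o)

namespace EqSystem

/-- `E'` CONTAINS THE `μ`-DEFLATION OF `E`: every test of `E` and its derivative `D_μ t` along the
coefficient field `μ` are tests of `E'`. -/
def DeflatesTo (E : EqSystem n) (μ : Fin n × Fin n → MvPolynomial (MatMulVars n) ℂ) (E' : EqSystem n) :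
    Prop :=
  (∀ j ∈ E.tests, ∃ j' ∈ E'.tests, E'.testPoly j' = E.testPoly j) ∧
    (∀ j ∈ E.tests, ∃ j' ∈ E'.tests, E'.testPoly j' = derivC μ (E.testPoly j))

/-- **ONE DEFLATION ROUND, system level.**  If the test ideal of `E` is initially isolated to
order `2` over `y`, there is a direction `γ` such that every system containing the `μ`-deflation
of `E` for a field with `μ(y) = γ` has its test ideal initially isolated to order `1` over `y`. -/
theorem IdealInitIsolatedAt.deflate {E : EqSystem n} {y : MatMulVars n → ℂ} (h : E.IdealInitIsolatedAt 2 y) :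
    ∃ γ : Fin n × Fin n → ℂ, ∀ μ : Fin n × Fin n → MvPolynomial (MatMulVars n) ℂ,
      (∀ q, eval y (μ q) = γ q) → ∀ E' : EqSystem n, E.DeflatesTo μ E' → E'.IdealInitIsolatedAt 1 y := by
  obtain ⟨γ, hγ⟩ := IdealInitIsolatedSet.deflate ((E.idealInitIsolatedAt_iff 2 y).mp h)
  refine ⟨γ, fun μ hμ E' hE' => (E'.idealInitIsolatedAt_iff 1 y).mpr (hγ μ hμ _ ?_ ?_)⟩
  · intro t ht
    obtain ⟨j, hj, rfl⟩ := (E.mem_testSet_iff t).mp ht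
    obtain ⟨j', hj', hjj'⟩ := hE'.1 j hj
    exact (E'.mem_testSet_iff _).mpr ⟨j', hj', hjj'⟩
  · intro t ht
    obtain ⟨j, hj, rfl⟩ := (E.mem_testSet_iff t).mp ht
    obtain ⟨j', hj', hjj'⟩ := hE'.2 j hj
    exact (E'.mem_testSet_iff _).mpr ⟨j', hj', hjj'⟩

/-- **… hence REDUCED** (rung M13b): a correct system containing a good deflation of `E` is
reduced at the graph point over `y`. -/
theorem IdealInitIsolatedAt.reducedAt_of_deflate {E : EqSystem n} {y : MatMulVars n → ℂ}
    (h : E.IdealInitIsolatedAt 2 y) :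
    ∃ γ : Fin n × Fin n → ℂ, ∀ μ : Fin n × Fin n → MvPolynomial (MatMulVars n) ℂ,
      (∀ q, eval y (μ q) = γ q) → ∀ E' : EqSystem n, E'.Correct → E.DeflatesTo μ E' →
        E'.ReducedAt (graphPoint y) := by
  obtain ⟨γ, hγ⟩ := h.deflate
  exact ⟨γ, fun μ hμ E' hE' hD => reducedAt_of_idealInitIsolatedAt_one hE' (hγ μ hμ E' hD)⟩

/-- The kernel-field condition is forced: a CORRECT deflation differentiates along a kernel field
(`D_μ t ∈ I` for every test `t` of `E`). -/
theorem DeflatesTo.derivC_mem_graphIdeal {E E' : EqSystem n} {μ : Fin n × Fin n → MvPolynomial (MatMulVars n) ℂ}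
    (hD : E.DeflatesTo μ E') (hE' : E'.Correct) {j : ℕ} (hj : j ∈ E.tests) :
    derivC μ (E.testPoly j) ∈ graphIdeal n := by
  obtain ⟨j', hj', hjj'⟩ := hD.2 j hj
  rw [← hjj']
  exact mem_graphIdeal_of_vanishing fun x hx => hE'.eval_testPoly_eq_zero hx hj'

end EqSystem

/-! ## The typed residual of rung `2` and its assembly -/

/-- **`KernelFieldDeflation β`** (`∃`-form residual of rung `K = 2`): for all `n ≥ 1` there are a
system `E`, a base pair `y`, a coefficient field `μ` whose value `μ(y)` is a DEFLATION DIRECTION for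
the test ideal of `E` over `y` (as delivered by `IdealInitIsolatedAt.deflate`), and a CORRECT system
`E'` of cost `O(n^β)` containing the `μ`-deflation of `E`.  Correctness of `E'` forces `μ` to be a
KERNEL FIELD (`DeflatesTo.derivC_mem_graphIdeal`); by `kernelFieldDeflation_iff` this `∃`-form is
EQUIVALENT to `EqAdmissibleIdealIso β 1` — the open content is `UniformKernelFieldDeflation`. -/
def KernelFieldDeflation (β : ℝ) : Prop :=
  ∃ c : ℝ, ∀ n : ℕ, 1 ≤ n → ∃ (E E' : EqSystem n) (y : MatMulVars n → ℂ)
    (μ : Fin n × Fin n → MvPolynomial (MatMulVars n) ℂ),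
    (∀ E'' : EqSystem n, E.DeflatesTo μ E'' → E''.IdealInitIsolatedAt 1 y) ∧
    E'.Correct ∧ E.DeflatesTo μ E' ∧ (E'.cost : ℝ) ≤ c * (n : ℝ) ^ β

/-- `KernelFieldDeflation β → EqAdmissibleIdealIso β 1` (hence `EqAdmissibleRed β`, `EqAdmissiblePure β`). -/
theorem KernelFieldDeflation.eqAdmissibleIdealIso_one {β : ℝ} (h : KernelFieldDeflation β) :
    EqAdmissibleIdealIso β 1 := by
  obtain ⟨c, hc⟩ := h
  refine ⟨c, fun n hn => ?_⟩
  obtain ⟨E, E', y, μ, hgood, hE', hD, hcost⟩ := hc n hn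
  exact ⟨E', hE', ⟨y, hgood E' hD⟩, hcost⟩

/-- **RUNG 2 OF BOP′ FROM THE RESIDUAL.**  If admissible order-`2` families can be deflated along
cheap kernel fields (`EqAdmissibleIdealIso β 2 → KernelFieldDeflation β'` for `β < β'`), then
bounded-order purification holds at order `2`:
`EqAdmissibleIdealIso β 2 → EqAdmissiblePure β'`. -/
theorem boundedOrderPurification_two_of_kernelFieldDeflation
    (h : ∀ β : ℝ, 2 ≤ β → EqAdmissibleIdealIso β 2 → ∀ β' : ℝ, β < β' → KernelFieldDeflation β')
    (β : ℝ) (hβ : 2 ≤ β) (hiso : EqAdmissibleIdealIso β 2) (β' : ℝ) (hββ' : β < β') :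
    EqAdmissiblePure β' :=
  eqAdmissiblePure_of_idealIso_one (h β hβ hiso β' hββ').eqAdmissibleIdealIso_one

/-- The direction half of the residual is a THEOREM: admissible order-`2` isolation supplies, for
each of its systems, a deflation direction `γ` — what remains open is a kernel field of admissible
cost taking the value `γ` (and the bookkeeping of forward differentiation). -/
theorem exists_direction_of_eqAdmissibleIdealIso_two {β : ℝ} (h : EqAdmissibleIdealIso β 2) :
    ∃ c : ℝ, ∀ n : ℕ, 1 ≤ n → ∃ (E : EqSystem n) (y : MatMulVars n → ℂ) (γ : Fin n × Fin n → ℂ),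
      E.Correct ∧ (E.cost : ℝ) ≤ c * (n : ℝ) ^ β ∧
      ∀ μ : Fin n × Fin n → MvPolynomial (MatMulVars n) ℂ, (∀ q, eval y (μ q) = γ q) →
        ∀ E' : EqSystem n, E.DeflatesTo μ E' → E'.IdealInitIsolatedAt 1 y := by
  obtain ⟨c, hc⟩ := h
  refine ⟨c, fun n hn => ?_⟩
  obtain ⟨E, hE, ⟨y, hy⟩, hcost⟩ := hc n hn
  obtain ⟨γ, hγ⟩ := hy.deflate
  exact ⟨E, y, γ, hE, hcost, hγ⟩

/-- CONVERSELY the `∃`-form follows from rung-`1` isolation with the ZERO field (`D_0 t = 0`; the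
extra test is an out-of-range index, whose value is the junk `0`): so
`KernelFieldDeflation β ↔ EqAdmissibleIdealIso β 1` — "order-one isolation = order-two isolation
deflated along a kernel field" is an EQUIVALENT REFORMULATION of the rung-`1` class; the open content
is the UNIFORM statement `UniformKernelFieldDeflation` below. -/
theorem KernelFieldDeflation.of_eqAdmissibleIdealIso_one {β : ℝ} (h : EqAdmissibleIdealIso β 1) :
    KernelFieldDeflation β := by
  obtain ⟨c, hc⟩ := h
  refine ⟨c, fun n hn => ?_⟩
  obtain ⟨E, hE, ⟨y, hy⟩, hcost⟩ := hc n hn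
  -- `Ez`: the same circuit, one extra (out-of-range, hence zero) test
  let Ez : EqSystem n := ⟨E.circuit, E.tests ++ [E.cost]⟩
  have htp : ∀ j, Ez.testPoly j = E.testPoly j := fun j => rfl
  have hzero : Ez.testPoly E.cost = 0 := by rw [htp]; exact EqSystem.testPoly_eq_zero_of_le le_rfl
  have hD : E.DeflatesTo 0 Ez := by
    refine ⟨fun j hj => ⟨j, List.mem_append_left _ hj, htp j⟩, fun j hj => ⟨E.cost, by simp [Ez], ?_⟩⟩
    rw [hzero, derivC]; simp
  have hgood : ∀ E'' : EqSystem n, E.DeflatesTo 0 E'' → E''.IdealInitIsolatedAt 1 y := fun E'' hE'' => by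
    rw [EqSystem.idealInitIsolatedAt_iff] at hy ⊢
    refine hy.mono (Ideal.span_mono fun t ht => ?_)
    obtain ⟨j, hj, rfl⟩ := (E.mem_testSet_iff t).mp ht
    obtain ⟨j', hj', hjj'⟩ := hE''.1 j hj
    exact (E''.mem_testSet_iff _).mpr ⟨j', hj', hjj'⟩
  have hcorr : Ez.Correct := by
    refine ⟨hE.1, Set.ext fun x => ⟨fun hx => ?_, fun hx => ?_⟩⟩
    · rw [← hE.2]
      exact fun j hj => by rw [← htp]; exact hx j (List.mem_append_left _ hj)
    · intro j hj
      rcases List.mem_append.mp hj with hj | hj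
      · rw [htp]; exact hE.eval_testPoly_eq_zero hx hj
      · rw [List.mem_singleton.mp hj, hzero, map_zero]
  exact ⟨E, Ez, y, 0, hgood, hcorr, hD, hcost⟩

/-- `KernelFieldDeflation β ↔ EqAdmissibleIdealIso β 1`. -/
theorem kernelFieldDeflation_iff {β : ℝ} : KernelFieldDeflation β ↔ EqAdmissibleIdealIso β 1 :=
  ⟨KernelFieldDeflation.eqAdmissibleIdealIso_one, KernelFieldDeflation.of_eqAdmissibleIdealIso_one⟩

/-! ## The sharp split of the residual: a ROUTINE bookkeeping statement and the open UNIFORM one -/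

/-- **`ForwardModeAD`** (ROUTINE · bookkeeping, unproved here): forward-mode differentiation of a
fan-in-two straight-line program along the derivation `D_μ = Σ_q μ_q(a,b) ∂/∂c_q`, given gates
computing the `μ_q`: a sum gate `c₁u + c₂w ↦ c₁Du + c₂Dw` (one gate), a product `uw ↦ Du·w + u·Dw`
(three gates), inputs `D a = D b = 0`, `D c_q = μ_q`; hence a system `E'` with the tests of `E`
AND their derivatives, of cost `≤ 4·cost E + cost E_μ` (Wengert 1964; BCS97 §7.1).  Only
EqSystem-level vocabulary is used; the proof is gate-list surgery (`gateValues_append`). -/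
def ForwardModeAD : Prop :=
  ∀ (n : ℕ) (E Eμ : EqSystem n) (μ : Fin n × Fin n → MvPolynomial (MatMulVars n) ℂ),
    E.circuit.IsFanInTwo → Eμ.circuit.IsFanInTwo →
    (∀ q, ∃ j ∈ Eμ.tests, Eμ.testPoly j = liftAB n (μ q)) →
    ∃ E' : EqSystem n, E'.circuit.IsFanInTwo ∧ E.DeflatesTo μ E' ∧
      (∀ j' ∈ E'.tests, (∃ j ∈ E.tests, E'.testPoly j' = E.testPoly j) ∨
        (∃ j ∈ E.tests, E'.testPoly j' = derivC μ (E.testPoly j))) ∧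
      E'.cost ≤ 4 * E.cost + Eμ.cost

/-- **`UniformKernelFieldDeflation β β'`** (UNDECIDED · the OPEN RESIDUAL of rung `2`): every correct
system `E` of cost `O(n^β)` whose test ideal is initially isolated to order `2` over some `y` admits a
KERNEL FIELD `μ` (`D_μ t ∈ I` for every test `t`) computable in `O(n^{β'})` operations whose value at
some base pair `y'` is a DEFLATION DIRECTION (every system containing the `μ`-deflation of `E` is
initially isolated to order `1` over `y'`).  By `IdealInitIsolatedAt.deflate` good directions exist
over the given `y` (any generic point of the kernel `N(y)` of the specialised linear members, where
all kernel-field values lie); the content is the COST of a field reaching one. -/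
def UniformKernelFieldDeflation (β β' : ℝ) : Prop :=
  ∀ c : ℝ, ∃ c' : ℝ, ∀ n : ℕ, 1 ≤ n → ∀ (E : EqSystem n) (y : MatMulVars n → ℂ),
    E.Correct → E.IdealInitIsolatedAt 2 y → (E.cost : ℝ) ≤ c * (n : ℝ) ^ β →
    ∃ (y' : MatMulVars n → ℂ) (μ : Fin n × Fin n → MvPolynomial (MatMulVars n) ℂ) (Eμ : EqSystem n),
      Eμ.circuit.IsFanInTwo ∧ (∀ q, ∃ j ∈ Eμ.tests, Eμ.testPoly j = liftAB n (μ q)) ∧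
      (Eμ.cost : ℝ) ≤ c' * (n : ℝ) ^ β' ∧
      (∀ j ∈ E.tests, derivC μ (E.testPoly j) ∈ graphIdeal n) ∧
      (∀ E'' : EqSystem n, E.DeflatesTo μ E'' → E''.IdealInitIsolatedAt 1 y')

/-- A deflation along a KERNEL FIELD of a CORRECT system whose tests are exactly "old tests or their
derivatives" is CORRECT. -/
theorem EqSystem.Correct.of_deflatesTo {E E' : EqSystem n}
    {μ : Fin n × Fin n → MvPolynomial (MatMulVars n) ℂ} (hE : E.Correct) (hfan : E'.circuit.IsFanInTwo)
    (hD : E.DeflatesTo μ E')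
    (htests : ∀ j' ∈ E'.tests, (∃ j ∈ E.tests, E'.testPoly j' = E.testPoly j) ∨
      (∃ j ∈ E.tests, E'.testPoly j' = derivC μ (E.testPoly j)))
    (hKF : ∀ j ∈ E.tests, derivC μ (E.testPoly j) ∈ graphIdeal n) : E'.Correct := by
  refine ⟨hfan, Set.ext fun x => ⟨fun hx => ?_, fun hx => ?_⟩⟩
  · rw [← hE.2]
    exact fun j hj => by obtain ⟨j', hj', he⟩ := hD.1 j hj; rw [← he]; exact hx j' hj'
  · intro j' hj'
    rcases htests j' hj' with ⟨j, hj, he⟩ | ⟨j, hj, he⟩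
    · rw [he]; exact hE.eval_testPoly_eq_zero hx hj
    · rw [he]; exact eval_eq_zero_of_mem_graphIdeal (hKF j hj) hx

/-- **ASSEMBLY OF THE RESIDUAL.**  `UniformKernelFieldDeflation β β' ∧ ForwardModeAD ⇒
(EqAdmissibleIdealIso β 2 → KernelFieldDeflation β')` for `2 ≤ β ≤ β'`. -/
theorem kernelFieldDeflation_of_uniform {β β' : ℝ} (hββ' : β ≤ β')
    (hU : UniformKernelFieldDeflation β β') (hAD : ForwardModeAD) (h : EqAdmissibleIdealIso β 2) :
    KernelFieldDeflation β' := by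
  obtain ⟨c, hc⟩ := h
  obtain ⟨c', hc'⟩ := hU c
  refine ⟨4 * max c 0 + max c' 0, fun n hn => ?_⟩
  obtain ⟨E, hE, ⟨y, hy⟩, hcost⟩ := hc n hn
  obtain ⟨y', μ, Eμ, hfanμ, hμ, hμcost, hKF, hgood⟩ := hc' n hn E y hE hy hcost
  obtain ⟨E', hfan', hD, htests, hcost'⟩ := hAD n E Eμ μ hE.1 hfanμ hμ
  refine ⟨E, E', y', μ, hgood, hE.of_deflatesTo hfan' hD htests hKF, hD, ?_⟩
  have hn1 : (1 : ℝ) ≤ n := by exact_mod_cast hn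
  have hpow : (n : ℝ) ^ β ≤ (n : ℝ) ^ β' := Real.rpow_le_rpow_of_exponent_le hn1 hββ'
  have hpos : 0 ≤ (n : ℝ) ^ β := Real.rpow_nonneg (Nat.cast_nonneg n) β
  have hpos' : 0 ≤ (n : ℝ) ^ β' := Real.rpow_nonneg (Nat.cast_nonneg n) β'
  have h1 : (E.cost : ℝ) ≤ max c 0 * (n : ℝ) ^ β' :=
    hcost.trans ((mul_le_mul_of_nonneg_right (le_max_left c 0) hpos).trans
      (mul_le_mul_of_nonneg_left hpow (le_max_right c 0)))
  have h2 : (Eμ.cost : ℝ) ≤ max c' 0 * (n : ℝ) ^ β' :=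
    hμcost.trans (mul_le_mul_of_nonneg_right (le_max_left c' 0) hpos')
  have h3 : (E'.cost : ℝ) ≤ 4 * E.cost + Eμ.cost := by exact_mod_cast hcost'
  linarith

/-- **RUNG 2 OF BOP′ FROM THE SHARP RESIDUAL**:
`(∀ β < β', UniformKernelFieldDeflation β β') ∧ ForwardModeAD ⇒ BOP′(2)`, i.e.
`EqAdmissibleIdealIso β 2 → EqAdmissiblePure β'` for `2 ≤ β < β'`. -/
theorem boundedOrderPurification_two_of_uniform
    (hU : ∀ β β' : ℝ, 2 ≤ β → β < β' → UniformKernelFieldDeflation β β') (hAD : ForwardModeAD)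
    (β : ℝ) (hβ : 2 ≤ β) (hiso : EqAdmissibleIdealIso β 2) (β' : ℝ) (hββ' : β < β') :
    EqAdmissiblePure β' :=
  eqAdmissiblePure_of_idealIso_one
    (kernelFieldDeflation_of_uniform hββ'.le (hU β β' hβ hββ') hAD hiso).eqAdmissibleIdealIso_one

end Summit.MatrixMultiplication.MatrixMultiplication.Theorems.GraphEquations

end
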